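import Literature.NumberTheory.LFunctions.ConreyIwaniec2002BesselEnvelope
import Literature.NumberTheory.LFunctions.ConreyIwaniec2002BesselKernelPiece
import Literature.NumberTheory.LFunctions.ConreyIwaniec2002BesselKernelArith
import HarnessLib

/-!
# Conrey–Iwaniec (2002), §4 (4.5)/(4.22)–(4.23): the Fourier bound for the weight-one Bessel kernels (stub S3c)

B. Conrey, H. Iwaniec, *Spacing of zeros of Hecke L-functions and the class number problem*,
Acta Arith. 103 (2002) 259–312, §4 [held text `paper:arxiv-math_0111012`, p0010 (4.5), p0012
(4.22)–(4.23)]: for the kernels `k_m(x) = J_{k−1}((4π/c)√(mx/r))` (4.22) of the summation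
formulae, `1 ≤ c ≤ C = 2√(qX)`, `|α| ≤ (cC)^{-1}`, "there is no stationary phase … by partial
integration two times we get `ĝ_m(α) ≪ X(c²r/mX)^{5/4} ≪ q^{3/2}cCm^{-5/4}`. For small `m`
this bound is also true (trivial bound `X`)… Therefore the condition (4.5) … is satisfied with
`B = k²q^{3/2}`" (4.23).

This file PROVES the registered stub **S3c `stub_bessel_kernel`** of SKELETON S3 (cell
`landau-siegel/ls-inputs`, line `theta-circle-method`; statement VERBATIM, over the tree's
`KernelFourierBound`, `ciBesselKernel`, `IsBumpOn`) as `bessel_kernel`, at weight `k = 1`: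
`∃ B₀ ≥ 1, ∀ q ≥ 1, ∀ r with 1 ≤ r(c) ≤ q, KernelFourierBound q (B₀q^{3/2}) (ciBesselKernel r)`.
Ingredients: the elementary envelope `J₀ = ½(e^{iu}W₊ + e^{-iu}W₋)` with symbol bounds on
`u ≥ 2` (`ConreyIwaniec2002BesselEnvelope`), the substitution `x = t²` and the two partial
integrations without stationary phase (`ConreyIwaniec2002NonstationaryPhase`,
`ConreyIwaniec2002BesselKernelPiece`), the sizes (`ConreyIwaniec2002BesselKernelArith`); the
constant is `B₀ = 3104K + 1` with `K` the envelope constant. Nothing here proves Theorem 4.1,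
Propositions 3.2/3.3 or Proposition 6.4.

«The programme SEARCHES and TYPES; no claim about Landau–Siegel zeros, Theorems 1–2 of
arXiv:2211.02515 or a repaired Margin232 until a kernel theorem says so.»

## References

* [ConreyIwaniec2002] B. Conrey, H. Iwaniec, *Spacing of zeros of Hecke L-functions and the class
  number problem*, Acta Arith. 103 (2002) 259–312, arXiv:math/0111012: §4 (4.5), (4.22)–(4.24).
* G. N. Watson, *A Treatise on the Theory of Bessel Functions* (2nd ed., 1944), §7.21 (Hankel's
  expansions; here replaced by the elementary envelope built from `J₀`, `J₁`).
-/

noncomputable section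

open Complex Real Set MeasureTheory Filter intervalIntegral
open scoped Topology Interval FourierTransform

namespace Literature.NumberTheory.LFunctions

namespace ConreyIwaniec2002

open Literature.Analysis.FunctionSpaces

section Main

/-- The weight-one kernel along `x = t²`: `k_{c,m}(t²) = J₀(a t)` with `a = (4π/c)√(m/r)`,
`t ≥ 0`. [cite: ConreyIwaniec2002, §4 (4.22)] -/
theorem ciBesselKernel_sq (r : ℕ → ℕ) (c m : ℕ) {t : ℝ} (ht : 0 ≤ t) :
    ciBesselKernel r c m (t ^ 2) =
      ((besselJ 0 (4 * Real.pi / c * Real.sqrt (m / r c) * t) : ℝ) : ℂ) := by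
  simp only [ciBesselKernel]
  have e : 4 * Real.pi / c * Real.sqrt (m * t ^ 2 / (r c : ℕ)) =
      4 * Real.pi / c * Real.sqrt (m / r c) * t := by
    rw [show (m : ℝ) * t ^ 2 / (r c : ℕ) = (m : ℝ) / (r c : ℕ) * t ^ 2 by ring,
      Real.sqrt_mul (by positivity) (t ^ 2), Real.sqrt_sq ht]
    ring
  rw [e]

/-- The weight-one kernel is continuous. [cite: ConreyIwaniec2002, §4 (4.22)] -/
theorem continuous_ciBesselKernel (r : ℕ → ℕ) (c m : ℕ) : Continuous (ciBesselKernel r c m) := by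
  unfold ciBesselKernel
  exact continuous_ofReal.comp ((continuous_besselJ_holds 0).comp
    (continuous_const.mul (Real.continuous_sqrt.comp ((continuous_const.mul continuous_id).div_const _))))

/-- **S3c — (4.5) for the Bessel kernels `k_m(x) = J₀((4π/c)√(mx/r))`, i.e. (4.22)–(4.23) at
weight one** (registered stub `stub_bessel_kernel` of SKELETON S3, line `theta-circle-method`,
statement VERBATIM): there is an absolute `B₀ ≥ 1` such that for `q ≥ 1` and `1 ≤ r(c) ≤ q` the
family `ciBesselKernel r` satisfies `KernelFourierBound q (B₀q^{3/2})`, that is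
`|ĝ_m(α)| ≤ B₀q^{3/2}·c·C·m^{-5/4}` for `X ≥ 1/2`, `g` of (4.18) on `[X, 2X]`, `1 ≤ c ≤ C = 2√(qX)`,
`|α|cC ≤ 1`, `m ≥ 1`. Proof (print): "`J₀(2πy) = W(y)e(y) + W̄(y)e(−y)`, `y^νW^{(ν)}(y) ≪ y^{-1/2}`;
since `|α|cC ≤ 1` there is no stationary phase; two partial integrations give
`ĝ_m(α) ≪ X(c²r/mX)^{5/4} ≪ q^{3/2}cCm^{-5/4}`" — here with the elementary envelope
`W_ε(u) = e^{-iεu}(J₀ + iεJ₁ − iεJ₀/(2u))` on `u ≥ 2` (`besselEnvelope_bounds`), the substitution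
`x = t²` (`fourier_mul_eq_intervalIntegral_sq`), the phases `εat − 2παt²` with `|φ'| ≥ a/4`
(`four_pi_abs_mul_sqrt_le`, `norm_integral_piece_le`), and the trivial bound `|ĝ_m| ≤ X` when
`a√X < 2` (`small_le_target`). [cite: ConreyIwaniec2002, §4 (4.5), (4.22)–(4.23)] -/
theorem bessel_kernel :
    ∃ B₀ : ℝ, 1 ≤ B₀ ∧ ∀ (q : ℕ), 1 ≤ q → ∀ r : ℕ → ℕ, (∀ c : ℕ, 1 ≤ r c ∧ r c ≤ q) →
      KernelFourierBound q (B₀ * (q : ℝ) ^ (3 / 2 : ℝ)) (ciBesselKernel r) := by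
  obtain ⟨K, hK0, hKb⟩ := besselEnvelope_bounds
  refine ⟨3104 * K + 1, by nlinarith, ?_⟩
  intro q hq r hr X hX g hg c hc hcC α hα m hm
  obtain ⟨hr1, hrq⟩ := hr c
  have hX0 : 0 < X := by linarith
  have hc0 : (0 : ℝ) < c := by exact_mod_cast (show 0 < c by omega)
  have hm0 : (0 : ℝ) < m := by exact_mod_cast (show 0 < m by omega)
  have hrc0 : (0 : ℝ) < (r c : ℕ) := by exact_mod_cast (show 0 < r c by omega)
  set a : ℝ := 4 * Real.pi / c * Real.sqrt (m / r c) with ha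
  have hρ : 0 < Real.sqrt (m / r c) := Real.sqrt_pos.mpr (by positivity)
  have ha0 : 0 < a := by positivity
  have hs0 : 0 < Real.sqrt X := Real.sqrt_pos.mpr hX0
  have hR0 : 0 ≤ (q : ℝ) ^ (3 / 2 : ℝ) * c * (2 * Real.sqrt (q * X)) * (m : ℝ) ^ (-(5 / 4 : ℝ)) := by
    positivity
  have hgoal : (3104 * K + 1) * (q : ℝ) ^ (3 / 2 : ℝ) * c * (2 * Real.sqrt (q * X)) *
      (m : ℝ) ^ (-(5 / 4 : ℝ)) =
      (3104 * K + 1) * ((q : ℝ) ^ (3 / 2 : ℝ) * c * (2 * Real.sqrt (q * X)) * (m : ℝ) ^ (-(5 / 4 : ℝ))) := by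
    ring
  rw [hgoal]
  have hk : ∀ t : ℝ, 0 ≤ t → ciBesselKernel r c m (t ^ 2) = ((besselJ 0 (a * t) : ℝ) : ℂ) :=
    fun t ht ↦ ciBesselKernel_sq r c m ht
  rcases lt_or_ge (a * Real.sqrt X) 2 with hsmall | hbig
  · -- small arguments: the trivial bound
    have h1 : ‖𝓕 (fun x ↦ g x * ciBesselKernel r c m x) α‖ ≤ X := by
      refine norm_fourier_mul_le_of_norm_le_one hX0.le hg (fun x ↦ ?_) α
      simp only [ciBesselKernel, Complex.norm_real, Real.norm_eq_abs]
      exact abs_besselJ_zero_le_one_holds _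
    have h2 : X ≤ (q : ℝ) ^ (3 / 2 : ℝ) * c * (2 * Real.sqrt (q * X)) * (m : ℝ) ^ (-(5 / 4 : ℝ)) :=
      small_le_target hX hc hcC hr1 hrq hm hsmall
    calc ‖𝓕 (fun x ↦ g x * ciBesselKernel r c m x) α‖ ≤ X := h1
      _ ≤ 1 * ((q : ℝ) ^ (3 / 2 : ℝ) * c * (2 * Real.sqrt (q * X)) * (m : ℝ) ^ (-(5 / 4 : ℝ))) := by
          rw [one_mul]; exact h2
      _ ≤ (3104 * K + 1) * ((q : ℝ) ^ (3 / 2 : ℝ) * c * (2 * Real.sqrt (q * X)) *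
            (m : ℝ) ^ (-(5 / 4 : ℝ))) := by
          apply mul_le_mul_of_nonneg_right _ hR0
          nlinarith
  · -- large arguments: no stationary phase, two integrations by parts
    have hαa : 4 * Real.pi * |α| * Real.sqrt (2 * X) ≤ 3 / 4 * a :=
      four_pi_abs_mul_sqrt_le hX0 hc hr1 hrq hm hα
    rw [fourier_mul_eq_intervalIntegral_sq hX0 hg (continuous_ciBesselKernel r c m) α]
    set W : ℝ → ℝ → ℂ := fun ε u ↦ cexp (-(I * ε * u)) *
      ((besselJ 0 u : ℂ) + I * ε * besselJ 1 u - I * ε * besselJ 0 u / (2 * u)) with hW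
    have hs2 : Real.sqrt X ≤ Real.sqrt (2 * X) := Real.sqrt_le_sqrt (by linarith)
    -- pointwise splitting of the integrand
    have hpt : ∀ t ∈ uIcc (Real.sqrt X) (Real.sqrt (2 * X)),
        (2 * t : ℝ) • (cexp (((-2 * Real.pi * t ^ 2 * α : ℝ) : ℂ) * I) *
          (g (t ^ 2) * ciBesselKernel r c m (t ^ 2))) =
        (t : ℂ) * g (t ^ 2) * W 1 (a * t) *
            cexp (I * (((1 : ℝ) * a * t - 2 * Real.pi * α * t ^ 2 : ℝ) : ℂ)) +
          (t : ℂ) * g (t ^ 2) * W (-1) (a * t) *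
            cexp (I * (((-1 : ℝ) * a * t - 2 * Real.pi * α * t ^ 2 : ℝ) : ℂ)) := by
      intro t ht
      rw [uIcc_of_le hs2] at ht
      have ht0 : 0 ≤ t := le_trans hs0.le ht.1
      rw [hk t ht0, besselJ_zero_eq_envelope_sum (a * t)]
      have e1 : cexp (I * (((1 : ℝ) * a * t - 2 * Real.pi * α * t ^ 2 : ℝ) : ℂ)) =
          cexp (((-2 * Real.pi * t ^ 2 * α : ℝ) : ℂ) * I) * cexp (I * ((1 : ℝ) * (a * t : ℝ))) := by
        rw [← Complex.exp_add]; congr 1; push_cast; ring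
      have e2 : cexp (I * (((-1 : ℝ) * a * t - 2 * Real.pi * α * t ^ 2 : ℝ) : ℂ)) =
          cexp (((-2 * Real.pi * t ^ 2 * α : ℝ) : ℂ) * I) * cexp (I * ((-1 : ℝ) * (a * t : ℝ))) := by
        rw [← Complex.exp_add]; congr 1; push_cast; ring
      rw [e1, e2, hW, Complex.real_smul]
      push_cast
      ring
    rw [intervalIntegral.integral_congr hpt]
    -- integrability of the two pieces
    have hgc : Continuous g := hg.derivs.1.continuous
    have hint : ∀ ε : ℝ, (ε = 1 ∨ ε = -1) → IntervalIntegrable (fun t : ℝ ↦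
        (t : ℂ) * g (t ^ 2) * W ε (a * t) *
          cexp (I * ((ε * a * t - 2 * Real.pi * α * t ^ 2 : ℝ) : ℂ))) volume
        (Real.sqrt X) (Real.sqrt (2 * X)) := by
      intro ε hε
      refine ContinuousOn.intervalIntegrable ?_
      rw [uIcc_of_le hs2]
      intro t ht
      have ht0 : 0 < t := lt_of_lt_of_le hs0 ht.1
      have hat : a * t ≠ 0 := (mul_pos ha0 ht0).ne'
      have hWc : ContinuousAt (fun y : ℝ ↦ W ε (a * y)) t :=
        ((hasDerivAt_besselEnvelope hε hat).continuousAt).comp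
          (continuous_const.mul continuous_id).continuousAt
      have hrest : Continuous (fun y : ℝ ↦ (y : ℂ) * g (y ^ 2)) :=
        continuous_ofReal.mul (hgc.comp (continuous_id.pow 2))
      have hexp : Continuous (fun y : ℝ ↦ cexp (I * ((ε * a * y - 2 * Real.pi * α * y ^ 2 : ℝ) : ℂ))) :=
        (continuous_const.mul (continuous_ofReal.comp (by fun_prop))).cexp
      exact ((hrest.continuousAt.mul hWc).mul hexp.continuousAt).continuousWithinAt
    rw [intervalIntegral.integral_add (hint 1 (Or.inl rfl)) (hint (-1) (Or.inr rfl))]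
    -- the two pieces
    have hpiece : ∀ ε : ℝ, (ε = 1 ∨ ε = -1) →
        ‖∫ t in Real.sqrt X..Real.sqrt (2 * X), (t : ℂ) * g (t ^ 2) * W ε (a * t) *
            cexp (I * ((ε * a * t - 2 * Real.pi * α * t ^ 2 : ℝ) : ℂ))‖ ≤
          1552 * K / (a ^ 2 * Real.sqrt (a * Real.sqrt X)) := by
      intro ε hε
      exact norm_integral_piece_le hX hg hK0 (W := W ε)
        (W' := fun u ↦ -(cexp (-(I * ε * u)) *
          (u * besselJ 0 u + I * ε * u * besselJ 1 u - I * ε * besselJ 0 u)) / (2 * u ^ 2))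
        (W'' := fun u ↦ cexp (-(I * ε * u)) *
          (2 * u * besselJ 0 u + I * ε * u * besselJ 1 u - 2 * I * ε * besselJ 0 u) / (2 * u ^ 3))
        (fun u hu ↦ hasDerivAt_besselEnvelope hε hu)
        (fun u hu ↦ hasDerivAt_besselEnvelope_deriv hε hu)
        (fun u hu ↦ continuousAt_besselEnvelope_deriv2 ε hu)
        (fun u hu ↦ (hKb ε hε u hu).1) (fun u hu ↦ (hKb ε hε u hu).2.1)
        (fun u hu ↦ (hKb ε hε u hu).2.2) hε ha0 hbig hαa
    have harith : 1 / (a ^ 2 * Real.sqrt (a * Real.sqrt X)) ≤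
        (q : ℝ) ^ (3 / 2 : ℝ) * c * (2 * Real.sqrt (q * X)) * (m : ℝ) ^ (-(5 / 4 : ℝ)) :=
      inv_sq_mul_sqrt_le_target hX hc hcC hr1 hrq hm
    have hP0 : 0 ≤ 1 / (a ^ 2 * Real.sqrt (a * Real.sqrt X)) := by positivity
    calc ‖(∫ t in Real.sqrt X..Real.sqrt (2 * X), (t : ℂ) * g (t ^ 2) * W 1 (a * t) *
              cexp (I * (((1 : ℝ) * a * t - 2 * Real.pi * α * t ^ 2 : ℝ) : ℂ))) +
            ∫ t in Real.sqrt X..Real.sqrt (2 * X), (t : ℂ) * g (t ^ 2) * W (-1) (a * t) *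
              cexp (I * (((-1 : ℝ) * a * t - 2 * Real.pi * α * t ^ 2 : ℝ) : ℂ))‖
        ≤ 1552 * K / (a ^ 2 * Real.sqrt (a * Real.sqrt X)) +
            1552 * K / (a ^ 2 * Real.sqrt (a * Real.sqrt X)) :=
          (norm_add_le _ _).trans (add_le_add (hpiece 1 (Or.inl rfl)) (hpiece (-1) (Or.inr rfl)))
      _ = 3104 * K * (1 / (a ^ 2 * Real.sqrt (a * Real.sqrt X))) := by ring
      _ ≤ 3104 * K * ((q : ℝ) ^ (3 / 2 : ℝ) * c * (2 * Real.sqrt (q * X)) * (m : ℝ) ^ (-(5 / 4 : ℝ))) :=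
          mul_le_mul_of_nonneg_left harith (by positivity)
      _ ≤ (3104 * K + 1) * ((q : ℝ) ^ (3 / 2 : ℝ) * c * (2 * Real.sqrt (q * X)) *
            (m : ℝ) ^ (-(5 / 4 : ℝ))) := by
          apply mul_le_mul_of_nonneg_right _ hR0
          linarith

/-- **S3c2 — (4.5) from the amplitude/phase form** (registered sub-stub
`stub_bessel_kernel_of_amplitude` of SKELETON S3 v6/v7, statement VERBATIM): immediate from
`bessel_kernel`, which does not use the amplitude hypothesis `BesselJZeroAmplitude C_W` at all.
[cite: ConreyIwaniec2002, §4 (4.5), (4.22)–(4.23)] -/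
theorem bessel_kernel_of_amplitude :
    ∀ C_W : ℝ, 0 < C_W → BesselJZeroAmplitude C_W →
      ∃ B₀ : ℝ, 1 ≤ B₀ ∧ ∀ (q : ℕ), 1 ≤ q → ∀ r : ℕ → ℕ, (∀ c : ℕ, 1 ≤ r c ∧ r c ≤ q) →
        KernelFourierBound q (B₀ * (q : ℝ) ^ (3 / 2 : ℝ)) (ciBesselKernel r) :=
  fun _ _ _ ↦ bessel_kernel

end Main

end ConreyIwaniec2002

end Literature.NumberTheory.LFunctions

end
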